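/-
Copyright (c) 2026 the pub-hodgecm-mathlib formalisation cell (harness21).  Prover seat hodgecm-mathlib-K2E4-p21 (g0) (outside hand on the E3 WILD CHAIN; K2E3-p17 (g0) FILE ↦ SEAT MAP 22:22:15Z:
«K2E4-p21 = NW-B»), Track B «K2-LIT» ∕ h413, unit U5Kazhdan of the line `K2_E3_EllipticInputs`: the WILD twin of ★ row-80 FILE NW-B-RAM `F0P3cStCharTSEPCrossNormZeroTame`.  2026-09-03.
-/
import Summits.HodgeConjecture.HodgeConjecture.Theorems.F0P3cStCharTSEPCrossNormZeroTame     -- ★ NW-B-RAM (the tame twin this file re-letters; brings ★ 73, ★ 72-NW, ★ (A)-RAM, ★ 58-W-RAM, ★ 61b-RAM, the frame)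
import Summits.HodgeConjecture.HodgeConjecture.Theorems.K2E3EPTracePairAtDatumWild          -- ★ 59-W(C) (K2E1b-p03, p855251): `innerG_char_eq_zero_of_forall_extension_split_of_isPseudoCoeff_epTwoFamilies_of_ramificationIdx_ne_one`
import Summits.HodgeConjecture.HodgeConjecture.Theorems.K2E3TreeOrbitDataGqsWild             -- ★ (A)-W (K2E3-p17): `exists_vertexOrbitData_gqs_of_ramificationIdx_ne_one`, `exists_edgeOrbitData_gqs_of_ramificationIdx_ne_one`
import HarnessLib

/-!
# K2_E3 road (h413 = stmt-HodgeConjecture-24833), unit U5Kazhdan — THE WILD ENGINE, FILE «NW-B»: CROSS-NORM-ZERO `⟨χ_{π′}, χ_π⟩_e = 0` on `G_v = U(Φ₃)(L⁺_v)` AT EVERY RAMIFIED PLACE,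
# WILD (dyadic) ONES INCLUDED (Rogawski 1990 §12.6 p. 187, Prop. 12.6.1 (b); Schneider–Stuhler 1997 §III.4)

Cell `pub/hodgecm-mathlib` (D-0151), Track B; seat K2E4-p21 (g0) as outside hand on the E3 wild chain (K2E3-plan (g1) DEALS BATCH #2 22:15:20Z; line lead K2E3-p17 (g0) FILE ↦ SEAT MAP
22:22:15Z «K2E4-p21 = NW-B `Theorems/K2E3EPCrossNormZeroWild.lean` (★ `F0P3cStCharTSEPCrossNormZeroTame` twin ⇒ PAYS W₂ with p16's consumer)»).  THEOREMS ONLY (no definition ∕ instance ∕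
notation ∕ named fact ∕ `sorry`); ★-only imports (never a `Cruxes/…/Lines` module); `--supports stmt-HodgeConjecture-24833 --as helper`.

WHAT.  ★ NW-B-RAM `F0P3cStCharTSEPCrossNormZeroTame` proves, at a TAMELY ramified place (the seven tame letters `hσ hvσ hϖ hσϖ hres h2 hnorm`, among them `h2 : |2|_w = 1`), that for
irreducible smooth `r, r′` of `G_v` with `Hom_G(r, r′) = 0` and every smooth extension of `r′` by `r′` split, `⟨χ_{[r′]}, χ_{[r]}⟩_e = 0` — through the Euler–Poincaré pseudo-coefficient
of `r` on the tree.  THIS FILE re-issues its three heads at EVERY RAMIFIED place `w ∣ v` (`he : e(w∣v) ≠ 1`), ANY uniformiser (`hϖ : |ϖ|_w = q⁻¹`), with NO hypothesis on `|2|_w` — so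
at the WILD (dyadic) places too — by the MAP's template rule: statements = the tame heads VERBATIM with the single binder substitution «`(hσ hvσ hϖ hσϖ hres h2 hnorm)` ↦ `(he) (hϖ)`»,
proofs = the tame proofs VERBATIM with the tame bricks replaced by their ★ wild twins: (A)-RAM `exists_vertexOrbitData_gqs_of_neg` ∕ `exists_edgeOrbitData_gqs_of_v_two` ↦ ★ (A)-W
`…_of_ramificationIdx_ne_one` (K2E3-p17), NW-A-RAM `innerG_char_eq_zero_of_forall_extension_split_of_isPseudoCoeff_epTwoFamilies_of_neg` ↦ ★ 59-W(C) `…_of_ramificationIdx_ne_one`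
(K2E1b-p03, p855251), 58-W-RAM `isPseudoCoeff_epFunction_of_neg_explicit` ↦ ★ 58-W-W `…_of_ramificationIdx_ne_one_explicit` (K2E3-p17).  Names `…_of_ramificationIdx_ne_one…`.
THIS EDITION (stage 1): §1-W only — the 3-TERM letters modulo the pseudo-coefficient head `hpc3` (its inputs (A)-W and 59-W(C) are ★); §2-W ∕ §3-W (the `hpc3`
discharge by 58-W-W and the (G3)-explicit construction) are APPENDED when ★ 58-W-W `K2E3K1PseudoCoeffWitnessWild` lands (append-only edition 2).
* §1-W **`innerG_char_cross_eq_zero_of_isPseudoCoeff_epThree_of_ramificationIdx_ne_one`**.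
HONEST LABEL: HC_CM is proved only modulo the 7 printed citations (2 remaining named inputs: hLiu418 = stmt-HodgeConjecture-24832, h413 = stmt-HodgeConjecture-24833) until rung 0 closes;
count-neutral helper of the E3 wild chain (socket W₂ `sig_K2E3InnerGCharCrossEqZeroWild` is paid by p16's consumer over this file); retires nothing by itself.

## References
* [Rogawski1990] J. D. Rogawski, *Automorphic Representations of Unitary Groups in Three Variables*, Ann. of Math. Stud. 123 (1990): §12.6 p. 187 (`Tr π′(f_π) = ⟨χ_{π′}, χ_π⟩_e`),
  Prop. 12.6.1 (b) p. 188.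
* [SchneiderStuhler1997] P. Schneider, U. Stuhler, *Representation theory and sheaves on the Bruhat–Tits building*, Publ. Math. IHÉS 85 (1997): §III.4 Thm. III.4.16 ff.
* [Kottwitz1988] R. E. Kottwitz, *Tamagawa numbers*, Ann. of Math. 127 (1988): §2 Theorem 2.
* [BruhatTits1972] F. Bruhat, J. Tits, *Groupes réductifs sur un corps local I*, Publ. Math. IHÉS 41 (1972): §10.
* [Jacobowitz1962] R. Jacobowitz, *Hermitian forms over local fields*, Amer. J. Math. 84 (1962): §§7–11.
-/

set_option autoImplicit false

set_option linter.dupNamespace false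

noncomputable section

open NumberField IsDedekindDomain MeasureTheory Filter Topology
open scoped Matrix MatrixGroups Pointwise Valued WithZero ComplexConjugate
open Literature.NumberTheory.Rogawski1990 Literature.NumberTheory.Rogawski1990.Ch12Sec5
open Literature.NumberTheory.Automorphic Literature.NumberTheory.Automorphic.UnitaryGroup Literature.NumberTheory.Automorphic.UnitaryLatticeTree
open Literature.NumberTheory.Automorphic.HermitianLattice
open Literature.NumberTheory.GaloisRepresentations
open Literature.Combinatorics.SimpleGraph Literature.Combinatorics.SimpleGraph.OrientedIncidence

namespace Summit.HodgeConjecture.HodgeConjecture.Cruxes.H413.K2E3EPCrossNormZeroWild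
open Summit.HodgeConjecture.HodgeConjecture.Cruxes.H413 Summit.HodgeConjecture.HodgeConjecture.Cruxes.H413.F0P3cStCharTSTorusDefs Summit.HodgeConjecture.HodgeConjecture.Cruxes.H413.F0P3cStCharTSEPNormOneUnr
open Summit.HodgeConjecture.HodgeConjecture.Cruxes.H413.F0P3cStCharTSK1UnrPseudoCoeffWitness
open Summit.HodgeConjecture.HodgeConjecture.Cruxes.H413.F0P3cStCharTSEPTraceOneAtDatum
open Summit.HodgeConjecture.HodgeConjecture.Cruxes.H413.F0P3cStCharTSTreeOrbitDataGqs
open Summit.HodgeConjecture.HodgeConjecture.Cruxes.H413.F0P3cStCharTSTreeOrbitDataGqsRamified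
open Summit.HodgeConjecture.HodgeConjecture.Cruxes.H413.F0P3cStCharTSEPCrossNormZeroUnr
open Summit.HodgeConjecture.HodgeConjecture.Cruxes.H413.F0P3cStCharTSEPCrossNormZeroTame
open Summit.HodgeConjecture.HodgeConjecture.Cruxes.H413.K2E3TreeOrbitDataGqsWild
open Summit.HodgeConjecture.HodgeConjecture.Cruxes.H413.F0P3cDyRamWildPlaceDatum

section Head

variable (L : Type) [Field L] [NumberField L] [IsCMField L] (v : HeightOneSpectrum (𝓞 ↥(maximalRealSubfield L)))

/-! ## §1-W CROSS-NORM-ZERO at EVERY RAMIFIED place in row 58's 3-TERM letters, modulo the pseudo-coefficient head `hpc3` -/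

/-- **CROSS-NORM-ZERO AT EVERY RAMIFIED PLACE (tame or WILD), 3-TERM letters — `⟨χ_{[r′]}, χ_{[r]}⟩_e = 0` MODULO the pseudo-coefficient head** (wild twin of ★ NW-B-RAM §1
`innerG_char_cross_eq_zero_of_isPseudoCoeff_epThree_of_neg`: the seven tame letters ↦ `(he : e(w∣v) ≠ 1) (hϖ)` IN SLOT; orbit data from ★ (A)-W `exists_vertexOrbitData_gqs_of_ramificationIdx_ne_one` ∕
`exists_edgeOrbitData_gqs_of_ramificationIdx_ne_one`; closed by ★ 59-W(C) `K2E3EPTracePairAtDatumWild.innerG_char_eq_zero_of_forall_extension_split_of_isPseudoCoeff_epTwoFamilies_of_ramificationIdx_ne_one`;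
every other binder and the conclusion VERBATIM, the fixed-vector hypothesis renamed `hex₀`).  For the base edge `d₁` with stabilisers `P₀ P₂ P₁`, the local representations `τ₀ τ₂ τ₁` of `r`, the
`K`-type pieces `f₀ f₂ f₁`, an irreducible smooth `r` with `r.ρ.fixedPoints (U x₀) ≠ ⊥` (`hex₀`), `hpc3 : 𝔇.IsPseudoCoeff [r] (μ(P₀)⁻¹ f₀ + μ(P₂)⁻¹ f₂ − μ(P₁)⁻¹ f₁)`, a second irreducible smooth
`r′` with every smooth extension of `r′` by `r′` split (`hsplit₂`) and `Hom_G(r, r′) = 0` (`hHom0`): `𝔇.innerG (𝔇.char [r′]) (𝔇.char [r]) = 0`.  Proof = the tame proof token for token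
(`ι₀ := Bool`, `ι₁ := Unit`, `Fintype.sum_bool`, `Fintype.sum_unique`), wild bricks substituted. [cite: Rogawski1990, §12.6 p. 187] [cite: SchneiderStuhler1997, §III.4] [cite: Kottwitz1988, §2] -/
theorem innerG_char_cross_eq_zero_of_isPseudoCoeff_epThree_of_ramificationIdx_ne_one
    (hns : ∀ w : PlacesOver L v, IsCMField.complexConj L • w.1 = w.1)
    (w : PlacesOver L v) (hw : IsCMField.complexConj L • w.1 = w.1) {ϖ : (w.1.adicCompletion L)}
    (he : v.asIdeal.ramificationIdx' w.1.asIdeal ≠ 1) (hϖ : Valued.v ϖ = WithZero.exp (-1 : ℤ))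
    (eA : (Gqs L v) ≃ₜ* ↥(unitaryGroupOfForm (galAdicCompletionMap (L := L) (IsCMField.complexConj L) hw) ((StdForm.antidiagonal 3).over (w.1.adicCompletion L))))
    {a : (Gqs L v) →* ((latticeGraph (galAdicCompletionMap (L := L) (IsCMField.complexConj L) hw) ϖ ((StdForm.antidiagonal 3).over (w.1.adicCompletion L))) ≃g (latticeGraph (galAdicCompletionMap (L := L) (IsCMField.complexConj L) hw) ϖ ((StdForm.antidiagonal 3).over (w.1.adicCompletion L))))} (ha : ∀ g, a g = latticeGraphIso (galAdicCompletionMap (L := L) (IsCMField.complexConj L) hw) ϖ ((StdForm.antidiagonal 3).over (w.1.adicCompletion L)) (eA g))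
    [MeasurableSpace (Gqs L v)] [BorelSpace (Gqs L v)]
    [∀ γ : Gqs L v, MeasurableSpace (Gqs L v ⧸ Subgroup.centralizer ({γ} : Set (Gqs L v)))] [MeasurableSpace (Gqs L v ⧸ Subgroup.center (Gqs L v))]
    {H : Type} [Group H] [TopologicalSpace H] [IsTopologicalGroup H] [MeasurableSpace H]
    (νQv : Measure (Gqs L v)) [νQv.IsHaarMeasure] [νQv.IsMulRightInvariant]
    -- the §12.5 datum and ★ PCT-OUT's letters
    (𝔇 : EllipticData (Gqs L v) H) (hμG : 𝔇.μG = νQv)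
    (hreg : ∀ γ : Gqs L v, γ ∈ 𝔇.regG ↔ IsRegularElt (γ.val : GL (Fin 3) (UnitaryGroup.LocalRing L v)))
    (hM1 : ∀ π : IrrClass (Gqs L v), Measurable (𝔇.char π) ∧ LocallyIntegrable (𝔇.char π) 𝔇.μG ∧
      (∀ x ∈ 𝔇.regG, ∀ᶠ y in 𝓝 x, 𝔇.char π y = 𝔇.char π x) ∧
      ∀ φ : Gqs L v → ℂ, IsLocSmooth φ → π.smoothTrace 𝔇.μG φ = ∫ x, φ x * 𝔇.char π x ∂𝔇.μG)
    (hWIF : 𝔇.WeylIntegrationFormula) (hC1 : 𝔇.EllCartanSubset) (hC2 : 𝔇.EllCartanAE) (hC3 : 𝔇.NonEllCartanAE) (hL2 : 𝔇.L2CharOnTorusAll)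
    (τ : Orientation (latticeGraph (galAdicCompletionMap (L := L) (IsCMField.complexConj L) hw) ϖ ((StdForm.antidiagonal 3).over (w.1.adicCompletion L)))) (hτ : ∀ d, τ.tail d < τ.head d)
    {e : ℕ} {U : {M : Submodule 𝒪[(w.1.adicCompletion L)] (Fin 3 → (w.1.adicCompletion L)) // IsVertex (galAdicCompletionMap (L := L) (IsCMField.complexConj L) hw) ϖ ((StdForm.antidiagonal 3).over (w.1.adicCompletion L)) M} → Subgroup (Gqs L v)}
    (hU : ∀ x g, g ∈ U x ↔ mapGL ((eA g : ↥(unitaryGroupOfForm (galAdicCompletionMap (L := L) (IsCMField.complexConj L) hw) ((StdForm.antidiagonal 3).over (w.1.adicCompletion L)))) : GL (Fin 3) (w.1.adicCompletion L)) x.1 = x.1 ∧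
      x.1.map ((Matrix.toLin' ((((eA g : ↥(unitaryGroupOfForm (galAdicCompletionMap (L := L) (IsCMField.complexConj L) hw) ((StdForm.antidiagonal 3).over (w.1.adicCompletion L)))) : GL (Fin 3) (w.1.adicCompletion L)) : Matrix (Fin 3) (Fin 3) (w.1.adicCompletion L)) - 1)).restrictScalars 𝒪[(w.1.adicCompletion L)]) ≤ scaleLattice (ϖ ^ (e + 1)) x.1)
    -- the base edge and its stabilisers (★ 48-datum ∕ row 58 letters)
    (d₁ : (latticeGraph (galAdicCompletionMap (L := L) (IsCMField.complexConj L) hw) ϖ ((StdForm.antidiagonal 3).over (w.1.adicCompletion L))).edgeSet) (P₀ P₂ P₁ : Subgroup (Gqs L v))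
    (hP₀ : ∀ g, g ∈ P₀ ↔ a g (τ.head d₁) = τ.head d₁) (hP₂ : ∀ g, g ∈ P₂ ↔ a g (τ.tail d₁) = τ.tail d₁) (hP₁ : ∀ g, g ∈ P₁ ↔ (a g).mapEdgeSet d₁ = d₁)
    (r : SmoothIrrep (Gqs L v)) (hex₀ : ∃ x₀ : {M : Submodule 𝒪[(w.1.adicCompletion L)] (Fin 3 → (w.1.adicCompletion L)) // IsVertex (galAdicCompletionMap (L := L) (IsCMField.complexConj L) hw) ϖ ((StdForm.antidiagonal 3).over (w.1.adicCompletion L)) M}, r.ρ.fixedPoints (U x₀) ≠ ⊥)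
    -- the three local representations and their `K`-type pieces (★ 48-datum ∕ row 58 letters)
    (τ₀ : Representation ℂ ↥P₀ ↥(r.ρ.fixedPoints (U (τ.head d₁))))
    (hτρ₀ : ∀ (p : ↥P₀) (x : ↥(r.ρ.fixedPoints (U (τ.head d₁)))), ((τ₀ p x : ↥(r.ρ.fixedPoints (U (τ.head d₁)))) : r.V) = r.ρ (p : (Gqs L v)) (x : r.V))
    (τ₂ : Representation ℂ ↥P₂ ↥(r.ρ.fixedPoints (U (τ.tail d₁))))
    (hτρ₂ : ∀ (p : ↥P₂) (x : ↥(r.ρ.fixedPoints (U (τ.tail d₁)))), ((τ₂ p x : ↥(r.ρ.fixedPoints (U (τ.tail d₁)))) : r.V) = r.ρ (p : (Gqs L v)) (x : r.V))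
    (τ₁ : Representation ℂ ↥P₁ ↥(r.ρ.fixedPoints (U (τ.head d₁) ⊔ U (τ.tail d₁))))
    (hτρ₁ : ∀ (p : ↥P₁) (x : ↥(r.ρ.fixedPoints (U (τ.head d₁) ⊔ U (τ.tail d₁)))), ((τ₁ p x : ↥(r.ρ.fixedPoints (U (τ.head d₁) ⊔ U (τ.tail d₁)))) : r.V) = r.ρ (p : (Gqs L v)) (x : r.V))
    {f₀ f₂ f₁ : (Gqs L v) → ℂ}
    (hfP₀ : ∀ (g : (Gqs L v)) (hg : g ∈ P₀), f₀ g = Representation.character τ₀ ⟨g, hg⟩⁻¹) (hf0₀ : ∀ g ∉ P₀, f₀ g = 0)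
    (hfP₂ : ∀ (g : (Gqs L v)) (hg : g ∈ P₂), f₂ g = Representation.character τ₂ ⟨g, hg⟩⁻¹) (hf0₂ : ∀ g ∉ P₂, f₂ g = 0)
    (hfP₁ : ∀ (g : (Gqs L v)) (hg : g ∈ P₁), f₁ g = Representation.character τ₁ ⟨g, hg⟩⁻¹) (hf0₁ : ∀ g ∉ P₁, f₁ g = 0)
    -- row 58's witnessed head S2a: the 3-term EP function IS a pseudo-coefficient of `σ = [r]`
    (hpc3 : 𝔇.IsPseudoCoeff (IrrClass.mk r)
      ((((νQv.real (P₀ : Set (Gqs L v)))⁻¹ : ℂ)) • f₀ + (((νQv.real (P₂ : Set (Gqs L v)))⁻¹ : ℂ)) • f₂ - (((νQv.real (P₁ : Set (Gqs L v)))⁻¹ : ℂ)) • f₁))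
    -- the CROSS letters: a second irreducible smooth `r′`; every SMOOTH extension of `r.ρ` BY `r′.ρ` splits (★ (J′)'s text at `V := r.ρ`, `W := r′.ρ`); `Hom_G(r, r′) = 0`
    (r' : SmoothIrrep (Gqs L v))
    (hsplit₂ : ∀ (E : Type) [AddCommGroup E] [Module ℂ E] (ρE : Representation ℂ (Gqs L v) E), ρE.IsSmooth →
      ∀ (i : r'.ρ.IntertwiningMap ρE) (p : ρE.IntertwiningMap r.ρ), Function.Injective i → LinearMap.ker p.toLinearMap = LinearMap.range i.toLinearMap →
        Function.Surjective p → ∃ s : r.ρ.IntertwiningMap ρE, p.comp s = Representation.IntertwiningMap.id r.ρ)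
    (hHom0 : Subsingleton (r.ρ.IntertwiningMap r'.ρ)) :
    𝔇.innerG (𝔇.char (IrrClass.mk r')) (𝔇.char (IrrClass.mk r)) = 0 := by
  classical
  obtain ⟨x₀, hx₀⟩ := hex₀
  -- the orbit data based at `d₁` (★ TreeOrbitDataGqs)
  obtain ⟨idx₀, tr₀, hidx₀, hidx₀a, htr₀⟩ := exists_vertexOrbitData_gqs_of_ramificationIdx_ne_one L v w hw he hϖ eA ha τ hτ d₁
  obtain ⟨tr₁, htr₁⟩ := exists_edgeOrbitData_gqs_of_ramificationIdx_ne_one L v w hw he hϖ eA ha τ hτ d₁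
  -- the Bool-indexed vertex families built from `(P₀, τ₀, f₀ ; P₂, τ₂, f₂)` and the Unit-indexed edge family `(P₁, τ₁, f₁)`
  let σ₀ : ∀ b : Bool, Representation ℂ ↥(cond b P₀ P₂) ↥(r.ρ.fixedPoints (U (cond b (τ.head d₁) (τ.tail d₁)))) := fun b =>
    match b with
    | true => τ₀
    | false => τ₂
  have hP : ∀ (b : Bool) (g : Gqs L v), g ∈ cond b P₀ P₂ ↔ a g (cond b (τ.head d₁) (τ.tail d₁)) = cond b (τ.head d₁) (τ.tail d₁) := fun b => by
    cases b
    · exact hP₂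
    · exact hP₀
  have hσ₀ : ∀ (b : Bool) (p : ↥(cond b P₀ P₂)) (x : ↥(r.ρ.fixedPoints (U (cond b (τ.head d₁) (τ.tail d₁))))),
      ((σ₀ b p x : ↥(r.ρ.fixedPoints (U (cond b (τ.head d₁) (τ.tail d₁))))) : r.V) = r.ρ (p : Gqs L v) (x : r.V) := fun b => by
    cases b
    · exact hτρ₂
    · exact hτρ₀
  have hfP : ∀ (b : Bool) (g : Gqs L v) (hg : g ∈ cond b P₀ P₂), cond b f₀ f₂ g = (σ₀ b).character ⟨g, hg⟩⁻¹ := fun b => by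
    cases b
    · exact hfP₂
    · exact hfP₀
  have hf0 : ∀ (b : Bool), ∀ g ∉ cond b P₀ P₂, cond b f₀ f₂ g = 0 := fun b => by
    cases b
    · exact hf0₂
    · exact hf0₀
  -- the two-family EP function of these families is the 3-term `f`
  have hf : ((∑ b : Bool, ((νQv.real (cond b P₀ P₂ : Set (Gqs L v)) : ℂ))⁻¹ • cond b f₀ f₂) -
      ∑ _u : Unit, ((νQv.real (P₁ : Set (Gqs L v)) : ℂ))⁻¹ • f₁) =
      (((νQv.real (P₀ : Set (Gqs L v)))⁻¹ : ℂ)) • f₀ + (((νQv.real (P₂ : Set (Gqs L v)))⁻¹ : ℂ)) • f₂ - (((νQv.real (P₁ : Set (Gqs L v)))⁻¹ : ℂ)) • f₁ := by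
    rw [Fintype.sum_bool, Fintype.sum_unique]
    rfl
  have hpc : 𝔇.IsPseudoCoeff (IrrClass.mk r) ((∑ b : Bool, ((νQv.real (cond b P₀ P₂ : Set (Gqs L v)) : ℂ))⁻¹ • cond b f₀ f₂) -
      ∑ _u : Unit, ((νQv.real (P₁ : Set (Gqs L v)) : ℂ))⁻¹ • f₁) := by
    rw [hf]; exact hpc3
  exact K2E3EPTracePairAtDatumWild.innerG_char_eq_zero_of_forall_extension_split_of_isPseudoCoeff_epTwoFamilies_of_ramificationIdx_ne_one L v hns w hw he hϖ eA ha νQv 𝔇 hμG hreg hM1 hWIF hC1 hC2 hC3 hL2 τ hτ hU r hx₀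
    (fun b => cond b (τ.head d₁) (τ.tail d₁)) idx₀ tr₀ hidx₀ hidx₀a htr₀ (fun b => cond b P₀ P₂) hP σ₀ hσ₀
    (fun _ : Unit => d₁) (fun _ => ()) tr₁ (fun _ => rfl) (fun _ _ => rfl) (fun d => htr₁ d) (fun _ => P₁) (fun _ => hP₁) (fun _ => τ₁) (fun _ => hτρ₁)
    (f₀ := fun b => cond b f₀ f₂) hfP hf0 (f₁ := fun _ => f₁) (fun _ => hfP₁) (fun _ => hf0₁) hpc r' hsplit₂ hHom0


end Head

end Summit.HodgeConjecture.HodgeConjecture.Cruxes.H413.K2E3EPCrossNormZeroWild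

end
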